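import Literature.Computability.QuantumComplexity.EncodedPrimitives
import Literature.Computability.QuantumComplexity.SignGateExpansion
import Literature.Computability.QuantumComplexity.JonesLoopCount
import HarnessLib

/-!
# Encoded simulation of a sign-basis circuit by a braid: the error estimate

Topic `Literature/Computability/QuantumComplexity`. Proof infrastructure for the
`PromiseBQP`-hardness of the Jones polynomial at `k = 5` (Aharonov–Arad 2011, Thm. 3.1, Claim 3.1
and §3): given, for every primitive operation (`SignGateExpansion.PrimOp`), a list of crossings
whose path-model operator intertwines the code isometry `encIso` with the primitive up to a unit
PHASE (`PrimOp.phase`: `i` for the one-qubit gates, whose `SU(2)` targets are `iH` and `iZ`, and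
`1` for the controlled phases) and a defect `≤ δ`, the concatenated braid simulates the whole
list: `‖ρ(b) · encIso - encIso · (c • opsMat ops)‖ ≤ |ops| δ` with `|c| = 1`
(`norm_braidOp_implOps_sub_le`, from `norm_prod_mul_sub_mul_prod_le`), hence the normalised Jones
value of the plat closure, `ajlRatio 5 (4n) b = |⟨α|ρ(b)|α⟩|` (`ajlRatio_eq_norm`), is within
`|ops| δ` of `|⟨0ⁿ|opsMat ops|0ⁿ⟩|` (`abs_ajlRatio_sub_le`); for the expansion of an oracle-free
circuit this is `|A_Q|` (`abs_ajlRatio_sub_abs_signAmplitude_le`), and a total error `≤ 1/20`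
separates QSIM's yes (`A_Q ≥ 3/5 ⇒ ratio ≥ 11/20`) from no (`|A_Q| ≤ 1/100 ⇒ ratio ≤ 3/10`)
instances (`ratio_ge_of_isYes`, `ratio_le_of_isNo`).

## References

* D. Aharonov, I. Arad, New J. Phys. 13 (2011) 035019, Thm. 3.1, Claim 3.1, §3 [AharonovArad2011].
* S. Aaronson, A. Ambainis, SIAM J. Comput. 47 (2018), §6 Lemma 24 [AaronsonAmbainis2018].
-/

noncomputable section

open scoped Matrix.Norms.L2Operator

namespace Literature.Computability.QuantumComplexity

open Matrix Cryptography Complex ExactCompiler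

variable {n : ℕ}

/-! ### Phases and contraction bounds of the primitives -/

/-- **The unit phase of a primitive**: the one-qubit targets are `iH`, `iZ ∈ SU(2)`. [cite: AharonovArad2011, §3.3] -/
def PrimOp.phase : PrimOp n → ℂ
  | PrimOp.had _ => I
  | PrimOp.zed _ => I
  | PrimOp.cp _ _ _ => 1

/-- The phase is a unit. [folklore] -/
theorem PrimOp.norm_phase (p : PrimOp n) : ‖p.phase‖ = 1 := by
  cases p <;> simp [PrimOp.phase]

/-- The phased matrix of a primitive. [cite: AharonovArad2011, §3.3] -/
def PrimOp.pmat (p : PrimOp n) : Matrix (QReg n) (QReg n) ℂ := p.phase • p.mat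

/-- The value of a `PhaseK` is a unit. [folklore] -/
theorem PhaseK.norm_val (u : PhaseK) : ‖u.val‖ = 1 := by
  cases u <;> simp [PhaseK.val]

/-- The controlled phase is unitary for a unit phase. [folklore] -/
theorem ctrlPhase_mem_unitaryGroup (a : ℕ) (ha : a + 2 ≤ n) {u : ℂ} (hu : ‖u‖ = 1) :
    Gadget.ctrlPhase a ha u ∈ Matrix.unitaryGroup (QReg n) ℂ := by
  rw [Matrix.mem_unitaryGroup_iff, Gadget.ctrlPhase, Matrix.star_eq_conjTranspose, Matrix.diagonal_conjTranspose,
    Matrix.diagonal_mul_diagonal, ← Matrix.diagonal_one]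
  congr 1
  funext x
  by_cases h : Gadget.Both a ha x
  · simp only [h, if_true, Pi.star_apply, RCLike.star_def]
    rw [Complex.mul_conj, Complex.normSq_eq_norm_sq, hu]; simp
  · simp [h]

/-- **The matrix of a primitive is unitary.** [folklore] -/
theorem PrimOp.mat_mem_unitaryGroup (p : PrimOp n) : p.mat ∈ Matrix.unitaryGroup (QReg n) ℂ := by
  cases p with
  | had a => exact placeGate_mem_unitaryGroup_holds (wireEmb a) hGate_mem_unitaryGroup_holds
  | zed a => exact placeGate_mem_unitaryGroup_holds (wireEmb a) pauliZ_mem_unitaryGroup_holds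
  | cp a ha u => exact ctrlPhase_mem_unitaryGroup a ha (PhaseK.norm_val u)

/-- A unitary matrix is a contraction. [folklore] -/
theorem norm_le_one_of_mem_unitaryGroup {m : Type*} [Fintype m] [DecidableEq m] {U : Matrix m m ℂ}
    (hU : U ∈ Matrix.unitaryGroup m ℂ) : ‖U‖ ≤ 1 :=
  norm_le_one_of_isometry (by rw [← Matrix.star_eq_conjTranspose]; exact Matrix.mem_unitaryGroup_iff'.1 hU)

/-- **The phased matrix of a primitive is a contraction.** [folklore] -/
theorem PrimOp.norm_pmat_le_one (p : PrimOp n) : ‖p.pmat‖ ≤ 1 := by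
  rw [PrimOp.pmat, norm_smul, p.norm_phase, one_mul]
  exact norm_le_one_of_mem_unitaryGroup p.mat_mem_unitaryGroup

/-! ### Concatenated implementations -/

/-- The crossings of a list of primitives under an implementation (operator order). [cite: AharonovArad2011, §3] -/
def implOps (impl : PrimOp n → List (Gen n)) (ops : List (PrimOp n)) : List (Gen n) := ops.flatMap impl

/-- The product of the phases. [folklore] -/
def phaseProd (ops : List (PrimOp n)) : ℂ := (ops.map PrimOp.phase).prod

/-- The product of the phases is a unit. [folklore] -/
theorem norm_phaseProd (ops : List (PrimOp n)) : ‖phaseProd ops‖ = 1 := by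
  induction ops with
  | nil => simp [phaseProd]
  | cons p ops ih => rw [phaseProd, List.map_cons, List.prod_cons, norm_mul, p.norm_phase, one_mul, ← phaseProd, ih]

/-- `phaseProd (p :: ops) = p.phase * phaseProd ops`. [folklore] -/
theorem phaseProd_cons (p : PrimOp n) (ops : List (PrimOp n)) : phaseProd (p :: ops) = p.phase * phaseProd ops := by
  simp [phaseProd]

/-- The phased matrices multiply to the phase times `opsMat`. [folklore] -/
theorem prod_pmat (ops : List (PrimOp n)) : (ops.map PrimOp.pmat).prod = phaseProd ops • opsMat ops := by
  induction ops with
  | nil => simp [phaseProd, opsMat]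
  | cons p ops ih =>
    rw [List.map_cons, List.prod_cons, ih, opsMat_cons, phaseProd_cons, PrimOp.pmat, Matrix.smul_mul, Matrix.mul_smul,
      smul_smul]

/-- The implementations multiply to the implementation of the list. [folklore] -/
theorem prod_map_braidOp (impl : PrimOp n → List (Gen n)) (ops : List (PrimOp n)) :
    (ops.map fun p => braidOp (impl p)).prod = braidOp (implOps impl ops) := by
  induction ops with
  | nil => simp [implOps]
  | cons p ops ih => rw [List.map_cons, List.prod_cons, ih, implOps, implOps, List.flatMap_cons, braidOp_append]

/-- A constant sum. [folklore] -/
theorem sum_map_const_real (ops : List (PrimOp n)) (δ : ℝ) : (ops.map fun _ => δ).sum = ops.length * δ := by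
  induction ops with
  | nil => simp
  | cons p ops ih => rw [List.map_cons, List.sum_cons, ih, List.length_cons]; push_cast; ring

/-- **Defects add up** (Aharonov–Arad Claim 3.1): if every primitive of `ops` is implemented with
defect `≤ δ`, the concatenation has defect `≤ |ops| δ` against `phaseProd ops • opsMat ops`.
[cite: AharonovArad2011, Claim 3.1] -/
theorem norm_braidOp_implOps_sub_le (impl : PrimOp n → List (Gen n)) (ops : List (PrimOp n)) {δ : ℝ}
    (hδ : ∀ p ∈ ops, ‖braidOp (impl p) * encIso n - encIso n * p.pmat‖ ≤ δ) :
    ‖braidOp (implOps impl ops) * encIso n - encIso n * (phaseProd ops • opsMat ops)‖ ≤ ops.length * δ := by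
  have h := norm_prod_mul_sub_mul_prod_le (E := encIso n) (ops.map fun p => (braidOp (impl p), p.pmat, δ)) (by
    intro t ht
    obtain ⟨p, hp, rfl⟩ := List.mem_map.1 ht
    exact ⟨norm_braidOp_le_one _, p.norm_pmat_le_one, hδ p hp⟩)
  have e1 : ((ops.map fun p => (braidOp (impl p), p.pmat, δ)).map (·.1)).prod = braidOp (implOps impl ops) := by
    rw [List.map_map, ← prod_map_braidOp]; rfl
  have e2 : ((ops.map fun p => (braidOp (impl p), p.pmat, δ)).map (·.2.1)).prod = phaseProd ops • opsMat ops := by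
    rw [List.map_map, ← prod_pmat]; rfl
  have e3 : ((ops.map fun p => (braidOp (impl p), p.pmat, δ)).map (·.2.2)).sum = ops.length * δ := by
    rw [List.map_map, ← sum_map_const_real ops δ]; rfl
  rw [e1, e2, e3] at h
  exact h

/-! ### The amplitude estimate -/

/-- **The normalised Jones value is close to `|⟨0ⁿ|opsMat ops|0ⁿ⟩|`.** [cite: AharonovArad2011, Thm. 3.1 (proof)] -/
theorem abs_ajlRatio_sub_le (hn : 1 ≤ n) (impl : PrimOp n → List (Gen n)) (ops : List (PrimOp n)) {δ : ℝ}
    (hδ : ∀ p ∈ ops, ‖braidOp (impl p) * encIso n - encIso n * p.pmat‖ ≤ δ) :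
    |ajlRatio 5 (n * 4) (implOps impl ops) - ‖opsMat ops (fun _ => false) (fun _ => false)‖| ≤ ops.length * δ := by
  rw [ajlRatio_eq_norm (by norm_num) ⟨n * 2, by ring⟩ (by omega), ajlBraidMatrix_eq_braidOp]
  have h := abs_norm_apply_ajlAlpha_sub_le (braidOp (implOps impl ops)) (phaseProd ops • opsMat ops)
  rw [Matrix.smul_apply, smul_eq_mul, norm_mul, norm_phaseProd, one_mul] at h
  exact h.trans (norm_braidOp_implOps_sub_le impl ops hδ)

/-- **For an oracle-free sign circuit, the normalised Jones value of the expansion's braid is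
close to `|A_Q|`.** [cite: AharonovArad2011, Thm. 3.1 (proof)] -/
theorem abs_ajlRatio_sub_abs_signAmplitude_le (hn : 1 ≤ n) (impl : PrimOp n → List (Gen n)) (gs : List (QGate hSign n))
    (hgs : ∀ g ∈ gs, g.IsOracleFree) {δ : ℝ}
    (hδ : ∀ p ∈ expandGates gs, ‖braidOp (impl p) * encIso n - encIso n * p.pmat‖ ≤ δ) :
    |ajlRatio 5 (n * 4) (implOps impl (expandGates gs)) - (|signAmplitude (⟨gs⟩ : QCircuit hSign n)| : ℝ)| ≤
      (expandGates gs).length * δ := by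
  have h := abs_ajlRatio_sub_le hn impl (expandGates gs) hδ
  rwa [opsMat_expandGates gs hgs, ← QCircuit.mat, ← signAmplitude_coe, Complex.norm_real, Real.norm_eq_abs] at h

/-- **Yes-instances give a large Jones value**: total error `≤ 1/20` and `A_Q ≥ 3/5` imply
`ratio ≥ 11/20`. [cite: AharonovArad2011, Thm. 3.1] -/
theorem ratio_ge_of_isYes (hn : 1 ≤ n) (impl : PrimOp n → List (Gen n)) (gs : List (QGate hSign n)) {δ : ℝ}
    (hδ : ∀ p ∈ expandGates gs, ‖braidOp (impl p) * encIso n - encIso n * p.pmat‖ ≤ δ)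
    (htot : (expandGates gs).length * δ ≤ 1 / 20) (hyes : (⟨n, ⟨gs⟩⟩ : QSimSignInstance).IsYes) :
    (11 / 20 : ℝ) ≤ ajlRatio 5 (n * 4) (implOps impl (expandGates gs)) := by
  obtain ⟨hof, hA⟩ := hyes
  have h := (abs_le.1 ((abs_ajlRatio_sub_abs_signAmplitude_le hn impl gs hof hδ).trans htot)).1
  change 3 / 5 ≤ signAmplitude (⟨gs⟩ : QCircuit hSign n) at hA
  have : (3 / 5 : ℝ) ≤ |signAmplitude (⟨gs⟩ : QCircuit hSign n)| := hA.trans (le_abs_self _)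
  linarith

/-- **No-instances give a small Jones value**: total error `≤ 1/20` and `|A_Q| ≤ 1/100` imply
`ratio ≤ 3/10`. [cite: AharonovArad2011, Thm. 3.1] -/
theorem ratio_le_of_isNo (hn : 1 ≤ n) (impl : PrimOp n → List (Gen n)) (gs : List (QGate hSign n)) {δ : ℝ}
    (hδ : ∀ p ∈ expandGates gs, ‖braidOp (impl p) * encIso n - encIso n * p.pmat‖ ≤ δ)
    (htot : (expandGates gs).length * δ ≤ 1 / 20) (hno : (⟨n, ⟨gs⟩⟩ : QSimSignInstance).IsNo) :
    ajlRatio 5 (n * 4) (implOps impl (expandGates gs)) ≤ 3 / 10 := by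
  obtain ⟨hof, hA⟩ := hno
  have h := (abs_le.1 ((abs_ajlRatio_sub_abs_signAmplitude_le hn impl gs hof hδ).trans htot)).2
  change |signAmplitude (⟨gs⟩ : QCircuit hSign n)| ≤ 1 / 100 at hA
  linarith

end Literature.Computability.QuantumComplexity

end
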